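import Mathlib
import Summits.Ventures.PercRepro2.Defs
import Summits.Ventures.PercRepro2.Independence
import Summits.Ventures.PercRepro2.Harris
import Summits.Ventures.PercRepro2.Graph
import Summits.Ventures.PercRepro2.Exploration
import Summits.Ventures.PercRepro2.Events
import Summits.Ventures.PercRepro2.FourFunctions
import Summits.Ventures.PercRepro2.Induced
import Summits.Ventures.PercRepro2.Frontier
import Summits.Ventures.PercRepro2.ObsIndependence
import Summits.Ventures.PercRepro2.BHK
import Summits.Ventures.PercRepro2.BHKEvents
import Summits.Ventures.PercRepro2.OrderPreservation
import Summits.Ventures.PercRepro2.OrderPreservationDual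
import Summits.Ventures.PercRepro2.VdBKahn
import Summits.Ventures.PercRepro2.BHKAvoid
import Summits.Ventures.PercRepro2.R2PrimeThreeReduction
import Summits.Ventures.PercRepro2.YBridge
import Summits.Ventures.PercRepro2.Yu1Functionals
import Summits.Ventures.PercRepro2.Yu1Events

import Summits.Ventures.PercRepro2.Yu1

/-!
# (L_B): the b-split theorem next to (Yu1) (blind cell PercRepro2, typer-1;
`proofs/LEAD-PROOFSHAPES.md` §8.9 ADDENDUM 13 (2))

Light-first exploration `S = C(a₁)` on `R = {a₂, a₃ ∉ S}`, with `u`, `β`, `1_b` of `Yu1Functionals`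
and the signed weight `ψ = β − 1_b (1 − u)` (on `R`, `β = 0` when `b ∈ S`, so `ψ = 1_{b∉S} β −
1_{b∈S}(1 − u)`): `T_{l→h} − Δ_l = E[1_o ψ; R] = P(o ∈ C₁, b ∈ C₂, R) − P(o ∈ C₁, b ∈ C₁, T)`,
`W = M₂ + Δ_T = E[ψ; R]`, `D′ = P(PD, b ∈ C₁) = E[1_b u; R]`, `C′ = P(PD, o ∈ C₁, b ∈ C₁) =
E[1_o 1_b u; R]`.

**(L_B)**: `(T_{l→h} − Δ_l) · D′ ≤ C′ · W` under the labelling `P(b ↔ a₁) ≤ P(b ↔ a₂)`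
(`lb_light`, division-free). Proof (the lead's multiplier argument, scaled by `D′` to avoid the
quotient `λ⁺ = W / D′`): `G := D′ (β − 1_b (1 − u)) − W 1_b u` is decreasing in `S` as soon as
`0 ≤ D′ ≤ W` — and `W − D′ = N_h − P(b ∈ C₁, R) ≥ 0` is R10d on `R` (`order_on_R`) — with
`E[G; R] = D′ W − W D′ = 0`; one BHK 1.3 (`bhk_induced`, `f = 1_o`, `F₂ = D′ − G` increasing,
nonnegative) gives `E[1_o G; R] · P(R) ≤ E[1_o; R] · E[G; R] = 0`, i.e. `(D′ (T_{l→h} − Δ_l) −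
W C′) · P(R) ≤ 0`. The cases `P(R) = 0` / `D′ = 0` need no separate treatment.
-/

namespace Summit.Ventures.PercRepro2

open UnionCluster Yu1

section LBEvents

variable {V : Type*} {E : Type*} [Fintype E] [DecidableEq E] [Fintype V] [DecidableEq V]
  {R : Type*} [Field R] [LinearOrder R] [IsStrictOrderedRing R]

omit [Fintype E] [DecidableEq E] [Fintype V] in
/-- `{o ∈ C₁} ∩ {b ∈ C₂} ∩ R` as a cluster event. -/
lemma ob_event_eq (ends : E → Sym2 V) (o a₁ a₂ a₃ b : V) :
    clusterInEvent ends a₁ {W | o ∈ W} ∩ clusterInEvent ends a₂ {W | b ∈ W} ∩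
        avoidAll ends a₁ {a₂, a₃} =
      connEvent ends a₁ o ∩ connEvent ends a₂ b ∩ avoidAll ends a₁ {a₂, a₃} := by
  ext ω
  simp [clusterInEvent]

omit [Fintype E] [DecidableEq E] [Fintype V] in
/-- `{o ∈ C₁} ∩ {b ∈ C₁} ∩ T` as a cluster event (`C₂ ∈ {a₃ ∈ ·}`). -/
lemma obT_event_eq (ends : E → Sym2 V) (o a₁ a₂ a₃ b : V) :
    clusterInEvent ends a₁ ({W | o ∈ W} ∩ {W | b ∈ W}) ∩ clusterInEvent ends a₂ {W | a₃ ∈ W} ∩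
        avoidAll ends a₁ {a₂, a₃} =
      connEvent ends a₁ o ∩ connEvent ends a₁ b ∩ TEvent ends a₁ a₂ a₃ := by
  have h := rb_event_eq ends a₁ a₂ a₃ b
  ext ω
  have key := Set.ext_iff.1 h ω
  simp only [clusterInEvent, Set.mem_inter_iff, Set.mem_setOf_eq, mem_cluster, mem_connEvent]
    at key ⊢
  tauto

omit [Fintype E] [DecidableEq E] [Fintype V] in
/-- `PD ∩ {o ∈ C₁} ∩ {b ∈ C₁}` as a cluster event. -/
lemma PDob_event_eq (ends : E → Sym2 V) (o a₁ a₂ a₃ b : V) :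
    clusterInEvent ends a₁ ({W | o ∈ W} ∩ {W | b ∈ W}) ∩ clusterInEvent ends a₂ {W | a₃ ∉ W} ∩
        avoidAll ends a₁ {a₂, a₃} =
      PDEvent ends a₁ a₂ a₃ ∩ connEvent ends a₁ o ∩ connEvent ends a₁ b := by
  have h := PD_event_eq ends a₁ a₂ a₃
  ext ω
  have key := Set.ext_iff.1 h ω
  simp only [clusterInEvent, Set.mem_inter_iff, Set.mem_setOf_eq, Set.mem_univ, true_and,
    mem_cluster, mem_connEvent] at key ⊢
  tauto

omit [LinearOrder R] [IsStrictOrderedRing R] in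
/-- Tower identity: `P(o ∈ C₁, b ∈ C₂, R) = E[1_o(C₁) β(C₁); R]`. -/
lemma tower_ob (p : E → R) (ends : E → Sym2 V) (o a₁ a₂ a₃ b : V) :
    prob p (connEvent ends a₁ o ∩ connEvent ends a₂ b ∩ avoidAll ends a₁ {a₂, a₃}) =
      expect p (fun ω => ind o (cluster ends ω a₁) * beta p ends a₂ b (cluster ends ω a₁) *
        (avoidAll ends a₁ {a₂, a₃}).indicator 1 ω) := by
  rw [← ob_event_eq, prob_clusterIn_inter_avoid_eq_expect p ends a₁ a₂ (X := {a₂, a₃})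
    (Finset.mem_insert_self a₂ {a₃})]
  rfl

omit [LinearOrder R] [IsStrictOrderedRing R] in
/-- Tower identity: `P(o ∈ C₁, b ∈ C₁, T) = E[1_o(C₁) 1_b(C₁) (1 − u(C₁)); R]`. -/
lemma tower_obT (p : E → R) (ends : E → Sym2 V) (o a₁ a₂ a₃ b : V) :
    prob p (connEvent ends a₁ o ∩ connEvent ends a₁ b ∩ TEvent ends a₁ a₂ a₃) =
      expect p (fun ω => ind o (cluster ends ω a₁) * ind b (cluster ends ω a₁) *
        (1 - u p ends a₂ a₃ (cluster ends ω a₁)) * (avoidAll ends a₁ {a₂, a₃}).indicator 1 ω) := by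
  rw [← obT_event_eq, prob_clusterIn_inter_avoid_eq_expect p ends a₁ a₂ (X := {a₂, a₃})
    (Finset.mem_insert_self a₂ {a₃})]
  simp only [one_sub_u, Set.inter_indicator_one, Pi.mul_apply]
  rfl

omit [LinearOrder R] [IsStrictOrderedRing R] in
/-- Tower identity: `P(PD, o ∈ C₁, b ∈ C₁) = E[1_o(C₁) 1_b(C₁) u(C₁); R]`. -/
lemma tower_PDob (p : E → R) (ends : E → Sym2 V) (o a₁ a₂ a₃ b : V) :
    prob p (PDEvent ends a₁ a₂ a₃ ∩ connEvent ends a₁ o ∩ connEvent ends a₁ b) =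
      expect p (fun ω => ind o (cluster ends ω a₁) * ind b (cluster ends ω a₁) *
        u p ends a₂ a₃ (cluster ends ω a₁) * (avoidAll ends a₁ {a₂, a₃}).indicator 1 ω) := by
  rw [← PDob_event_eq, prob_clusterIn_inter_avoid_eq_expect p ends a₁ a₂ (X := {a₂, a₃})
    (Finset.mem_insert_self a₂ {a₃})]
  simp only [Set.inter_indicator_one, Pi.mul_apply]
  rfl

omit [LinearOrder R] [IsStrictOrderedRing R] in
/-- `W = M₂ + Δ_T = E[β; R] − E[1_b (1 − u); R]`. -/
lemma W_eq (p : E → R) (ends : E → Sym2 V) (a₁ a₂ a₃ b : V) :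
    massM2 p ends a₁ a₂ a₃ b + deltaT p ends a₁ a₂ a₃ b =
      expect p (fun ω => beta p ends a₂ b (cluster ends ω a₁) *
        (avoidAll ends a₁ {a₂, a₃}).indicator 1 ω) -
      expect p (fun ω => ind b (cluster ends ω a₁) * (1 - u p ends a₂ a₃ (cluster ends ω a₁)) *
        (avoidAll ends a₁ {a₂, a₃}).indicator 1 ω) := by
  have h := Nh_eq p ends a₁ a₂ a₃ b
  rw [tower_N] at h
  unfold deltaT
  rw [tower_r, h]
  ring

end LBEvents

section LBMain

variable {V : Type*} {E : Type*} [Fintype E] [DecidableEq E] [Fintype V] [DecidableEq V]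
  {R : Type*} [Field R] [LinearOrder R] [IsStrictOrderedRing R]

omit [Fintype V] [DecidableEq V] in
/-- The multiplier weight `G = D′ (β − 1_b (1 − u)) − W 1_b u` is decreasing once `0 ≤ D′ ≤ W`. -/
lemma G_anti (p : E → R) (hp : IsProbVec p) (ends : E → Sym2 V) (a₂ a₃ b : V) {D' Wt : R}
    (hD : 0 ≤ D') (hDW : D' ≤ Wt) :
    Antitone (fun S : Set V => D' * (beta p ends a₂ b S - ind b S * (1 - u p ends a₂ a₃ S)) -
      Wt * (ind b S * u p ends a₂ a₃ S)) := by
  intro S S' h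
  simp only
  have hβ : D' * beta p ends a₂ b S' ≤ D' * beta p ends a₂ b S :=
    mul_le_mul_of_nonneg_left (beta_anti p hp ends a₂ b h) hD
  have hu : (Wt - D') * u p ends a₂ a₃ S ≤ (Wt - D') * u p ends a₂ a₃ S' :=
    mul_le_mul_of_nonneg_left (u_mono p hp ends a₂ a₃ h) (sub_nonneg.2 hDW)
  have hu0' : 0 ≤ (Wt - D') * u p ends a₂ a₃ S' :=
    mul_nonneg (sub_nonneg.2 hDW) (u_nonneg p hp ends a₂ a₃ S')
  unfold ind
  by_cases hb : b ∈ S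
  · have hb' : b ∈ S' := h hb
    rw [Set.indicator_of_mem (show S ∈ {W : Set V | b ∈ W} from hb),
      Set.indicator_of_mem (show S' ∈ {W : Set V | b ∈ W} from hb')]
    simp only [Pi.one_apply]
    linarith
  · rw [Set.indicator_of_notMem (show S ∉ {W : Set V | b ∈ W} from hb)]
    by_cases hb' : b ∈ S'
    · rw [Set.indicator_of_mem (show S' ∈ {W : Set V | b ∈ W} from hb')]
      simp only [Pi.one_apply]
      linarith
    · rw [Set.indicator_of_notMem (show S' ∉ {W : Set V | b ∈ W} from hb')]
      simp only [zero_mul, mul_zero, sub_zero]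
      exact hβ

omit [Fintype V] [DecidableEq V] in
/-- `G ≤ D′` pointwise (so `D′ − G ≥ 0`) once `0 ≤ D′ ≤ W`. -/
lemma G_le (p : E → R) (hp : IsProbVec p) (ends : E → Sym2 V) (a₂ a₃ b : V) {D' Wt : R}
    (hD : 0 ≤ D') (hDW : D' ≤ Wt) (S : Set V) :
    D' * (beta p ends a₂ b S - ind b S * (1 - u p ends a₂ a₃ S)) -
      Wt * (ind b S * u p ends a₂ a₃ S) ≤ D' := by
  have h1 : D' * beta p ends a₂ b S ≤ D' * 1 :=
    mul_le_mul_of_nonneg_left (beta_le_one p hp ends a₂ b S) hD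
  have h2 : 0 ≤ D' * (ind b S * (1 - u p ends a₂ a₃ S)) :=
    mul_nonneg hD (mul_nonneg (ind_nonneg b S) (sub_nonneg.2 (u_le_one p hp ends a₂ a₃ S)))
  have h3 : 0 ≤ Wt * (ind b S * u p ends a₂ a₃ S) :=
    mul_nonneg (hD.trans hDW) (mul_nonneg (ind_nonneg b S) (u_nonneg p hp ends a₂ a₃ S))
  linarith

/-- **(L_B)** (ADDENDUM 13 (2)), division-free: with `R = {a₂, a₃ ∉ C₁}`, `T = {a₁ ∉ C₂, a₃ ∈ C₂}`,
`W = M₂ + Δ_T`, under the labelling `P(b ↔ a₁) ≤ P(b ↔ a₂)`: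
`[P(o ∈ C₁, b ∈ C₂, R) − P(o ∈ C₁, b ∈ C₁, T)] · P(PD, b ∈ C₁) ≤ P(PD, o ∈ C₁, b ∈ C₁) · W`. -/
theorem lb_light (p : E → R) (hp : IsProbVec p) (ends : E → Sym2 V) {o a₁ a₂ a₃ b : V}
    (hord : prob p (connEvent ends a₁ b) ≤ prob p (connEvent ends a₂ b)) :
    (prob p (connEvent ends a₁ o ∩ connEvent ends a₂ b ∩ avoidAll ends a₁ {a₂, a₃}) -
        prob p (connEvent ends a₁ o ∩ connEvent ends a₁ b ∩ TEvent ends a₁ a₂ a₃)) *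
      prob p (PDEvent ends a₁ a₂ a₃ ∩ connEvent ends a₁ b) ≤
    prob p (PDEvent ends a₁ a₂ a₃ ∩ connEvent ends a₁ o ∩ connEvent ends a₁ b) *
      (massM2 p ends a₁ a₂ a₃ b + deltaT p ends a₁ a₂ a₃ b) := by
  -- names for the two constants of the weight
  set D' := prob p (PDEvent ends a₁ a₂ a₃ ∩ connEvent ends a₁ b) with hD'
  set Wt := massM2 p ends a₁ a₂ a₃ b + deltaT p ends a₁ a₂ a₃ b with hWt
  have hind : ∀ ω, 0 ≤ (avoidAll ends a₁ {a₂, a₃}).indicator (1 : Config E → R) ω :=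
    fun _ => Set.indicator_apply_nonneg fun _ => zero_le_one
  -- `0 ≤ D′` and `D′ ≤ W` (R10d on `R`)
  have hD : 0 ≤ D' := prob_nonneg hp _
  have hDW : D' ≤ Wt := by
    have s4 := order_on_R p hp ends (a₃ := a₃) hord
    rw [tower_b, tower_N] at s4
    have eB : expect p (fun ω => ind b (cluster ends ω a₁) *
        (avoidAll ends a₁ {a₂, a₃}).indicator 1 ω) =
        expect p (fun ω => ind b (cluster ends ω a₁) * (1 - u p ends a₂ a₃ (cluster ends ω a₁)) *
          (avoidAll ends a₁ {a₂, a₃}).indicator 1 ω) +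
        expect p (fun ω => ind b (cluster ends ω a₁) * u p ends a₂ a₃ (cluster ends ω a₁) *
          (avoidAll ends a₁ {a₂, a₃}).indicator 1 ω) := by
      rw [← expect_add]
      congr 1
      funext ω
      simp only [Pi.add_apply]
      ring
    rw [hWt, W_eq, hD', tower_PDo]
    linarith
  -- BHK 1.3 with `f = 1_o`, `F₂ = D′ − G`
  have hGanti := G_anti p hp ends a₂ a₃ b hD hDW
  have hF₂ : Monotone (fun S : Set V => D' - (D' * (beta p ends a₂ b S -
      ind b S * (1 - u p ends a₂ a₃ S)) - Wt * (ind b S * u p ends a₂ a₃ S))) :=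
    fun S S' h => sub_le_sub_left (hGanti h) D'
  have hF₂0 : ∀ S : Set V, 0 ≤ D' - (D' * (beta p ends a₂ b S -
      ind b S * (1 - u p ends a₂ a₃ S)) - Wt * (ind b S * u p ends a₂ a₃ S)) :=
    fun S => sub_nonneg.2 (G_le p hp ends a₂ a₃ b hD hDW S)
  have h := bhk_induced p hp ends a₁ (F₁ := (ind o : Set V → R)) (ind_mono o) hF₂ (ind_nonneg o)
    hF₂0 Finset.univ {a₂, a₃} {a₂, a₃} (Finset.subset_univ _) (Finset.subset_univ _)
  simp only [REvent_univ, Finset.inter_self, Finset.union_self, expect_clusterObs_univ,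
    Pi.mul_apply] at h
  -- the two linear expansions
  have eG : expect p (fun ω => (D' - (D' * (beta p ends a₂ b (cluster ends ω a₁) -
      ind b (cluster ends ω a₁) * (1 - u p ends a₂ a₃ (cluster ends ω a₁))) -
      Wt * (ind b (cluster ends ω a₁) * u p ends a₂ a₃ (cluster ends ω a₁)))) *
      (avoidAll ends a₁ {a₂, a₃}).indicator 1 ω) =
      D' * prob p (avoidAll ends a₁ {a₂, a₃}) := by
    have e1 : (fun ω => (D' - (D' * (beta p ends a₂ b (cluster ends ω a₁) -
        ind b (cluster ends ω a₁) * (1 - u p ends a₂ a₃ (cluster ends ω a₁))) -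
        Wt * (ind b (cluster ends ω a₁) * u p ends a₂ a₃ (cluster ends ω a₁)))) *
        (avoidAll ends a₁ {a₂, a₃}).indicator 1 ω) =
        (fun ω => D' * (avoidAll ends a₁ {a₂, a₃}).indicator 1 ω) -
        ((fun ω => D' * (beta p ends a₂ b (cluster ends ω a₁) *
            (avoidAll ends a₁ {a₂, a₃}).indicator 1 ω)) -
          (fun ω => D' * (ind b (cluster ends ω a₁) * (1 - u p ends a₂ a₃ (cluster ends ω a₁)) *
            (avoidAll ends a₁ {a₂, a₃}).indicator 1 ω))) +
        (fun ω => Wt * (ind b (cluster ends ω a₁) * u p ends a₂ a₃ (cluster ends ω a₁) *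
            (avoidAll ends a₁ {a₂, a₃}).indicator 1 ω)) := by
      funext ω
      simp only [Pi.add_apply, Pi.sub_apply]
      ring
    rw [e1, expect_add, expect_sub, expect_sub, expect_const_mul, expect_const_mul,
      expect_const_mul, expect_const_mul, ← prob_eq_expect_indicator, ← tower_PDo, ← hD']
    have hW : Wt = expect p (fun ω => beta p ends a₂ b (cluster ends ω a₁) *
        (avoidAll ends a₁ {a₂, a₃}).indicator 1 ω) -
        expect p (fun ω => ind b (cluster ends ω a₁) * (1 - u p ends a₂ a₃ (cluster ends ω a₁)) *
          (avoidAll ends a₁ {a₂, a₃}).indicator 1 ω) := by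
      rw [hWt, W_eq]
    rw [hW]
    ring
  have eoG : expect p (fun ω => ind o (cluster ends ω a₁) *
      (D' - (D' * (beta p ends a₂ b (cluster ends ω a₁) -
        ind b (cluster ends ω a₁) * (1 - u p ends a₂ a₃ (cluster ends ω a₁))) -
        Wt * (ind b (cluster ends ω a₁) * u p ends a₂ a₃ (cluster ends ω a₁)))) *
      (avoidAll ends a₁ {a₂, a₃}).indicator 1 ω) =
      D' * expect p (fun ω => ind o (cluster ends ω a₁) *
          (avoidAll ends a₁ {a₂, a₃}).indicator 1 ω) -
        (D' * (prob p (connEvent ends a₁ o ∩ connEvent ends a₂ b ∩ avoidAll ends a₁ {a₂, a₃}) -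
          prob p (connEvent ends a₁ o ∩ connEvent ends a₁ b ∩ TEvent ends a₁ a₂ a₃)) -
         Wt * prob p (PDEvent ends a₁ a₂ a₃ ∩ connEvent ends a₁ o ∩ connEvent ends a₁ b)) := by
    have e1 : (fun ω => ind o (cluster ends ω a₁) *
        (D' - (D' * (beta p ends a₂ b (cluster ends ω a₁) -
          ind b (cluster ends ω a₁) * (1 - u p ends a₂ a₃ (cluster ends ω a₁))) -
          Wt * (ind b (cluster ends ω a₁) * u p ends a₂ a₃ (cluster ends ω a₁)))) *
        (avoidAll ends a₁ {a₂, a₃}).indicator 1 ω) =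
        (fun ω => D' * (ind o (cluster ends ω a₁) * (avoidAll ends a₁ {a₂, a₃}).indicator 1 ω)) -
        ((fun ω => D' * (ind o (cluster ends ω a₁) * beta p ends a₂ b (cluster ends ω a₁) *
            (avoidAll ends a₁ {a₂, a₃}).indicator 1 ω)) -
          (fun ω => D' * (ind o (cluster ends ω a₁) * ind b (cluster ends ω a₁) *
            (1 - u p ends a₂ a₃ (cluster ends ω a₁)) *
            (avoidAll ends a₁ {a₂, a₃}).indicator 1 ω))) +
        (fun ω => Wt * (ind o (cluster ends ω a₁) * ind b (cluster ends ω a₁) *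
            u p ends a₂ a₃ (cluster ends ω a₁) * (avoidAll ends a₁ {a₂, a₃}).indicator 1 ω)) := by
      funext ω
      simp only [Pi.add_apply, Pi.sub_apply]
      ring
    rw [e1, expect_add, expect_sub, expect_sub, expect_const_mul, expect_const_mul,
      expect_const_mul, expect_const_mul, ← tower_ob, ← tower_obT, ← tower_PDob]
    ring
  rw [eG, eoG] at h
  -- `E[1_o G; R] · P(R) ≤ 0`, then cancel `P(R)`
  have hPR : 0 ≤ prob p (avoidAll ends a₁ {a₂, a₃}) := prob_nonneg hp _
  have key : (D' * (prob p (connEvent ends a₁ o ∩ connEvent ends a₂ b ∩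
      avoidAll ends a₁ {a₂, a₃}) -
      prob p (connEvent ends a₁ o ∩ connEvent ends a₁ b ∩ TEvent ends a₁ a₂ a₃)) -
      Wt * prob p (PDEvent ends a₁ a₂ a₃ ∩ connEvent ends a₁ o ∩ connEvent ends a₁ b)) *
      prob p (avoidAll ends a₁ {a₂, a₃}) ≤ 0 := by
    linarith [h]
  rcases hPR.lt_or_eq with hpos | hzero
  · have := nonpos_of_mul_nonpos_left key hpos
    linarith
  · -- `P(R) = 0`: every expectation against `1_R` vanishes
    have hz : ∀ g : Config E → R,
        expect p (fun ω => g ω * (avoidAll ends a₁ {a₂, a₃}).indicator 1 ω) = 0 :=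
      fun g => expect_mul_indicator_eq_zero_of_null hp hzero.symm g
    rw [tower_ob, tower_obT, hD', tower_PDo, tower_PDob, hz, hz, hz, hz]
    simp

end LBMain

end Summit.Ventures.PercRepro2
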